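import Literature.AlgebraicGeometry.HodgeTheory.CyclicReflectionEigencomponentsNonzero
import HarnessLib

/-!
# A cyclic reflection acts on each eigenspace `H(ζ^j)` as the complex reflection in `δ_j`
# (Carlson–Toledo 1999, §6 Proposition 2 / §7) — packaging, part 5

Family `hodge`, layer `Literature/AlgebraicGeometry/HodgeTheory`. THEOREMS only. Sequel of
`CyclicReflectionEigencomponentsNonzero`, for crux K1 of
`Summits/HodgeConjecture/HodgeConjecture/Theses/CyclicUnitaryPowers.lean` (R1 packaging, lanes A/D).

A *cyclic reflection* in the sense of statement D is a rational automorphism `r` of `(V, B)` with `r = τ` on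
the cyclic span `W = span_ℚ {τ^i δ}` of a vanishing vector `δ` and `r = id` on `W^⊥`.  We prove Carlson–Toledo's
formula for its complexification on the eigenspace `H(ζ^j)` of `τ ⊗ ℂ` (`1 ≤ j < p`):
`r_ℂ x = x + (ζ^j − 1) (h(δ_j, x) / h(δ_j, δ_j)) δ_j` — a complex reflection with root `δ_j` and multiplier `ζ^j`
for the hermitian form `h(x, y) = B_ℂ(x̄, y)` ("`T^i_{δ_i}(x) = x + (ζ^i − 1) ε_i h(x, δ_i) δ_i`", loc. cit.).
Ingredients: `r_ℂ = τ_ℂ` on `W ⊗ ℂ` and `= id` on `W^⊥ ⊗ ℂ` (§1); `V = W ⊕ W^⊥` after `⊗ ℂ` (§2); a vector of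
`H(ζ^j)` that is `h`-orthogonal to `δ_j` is `B_ℂ`-orthogonal to all of `W ⊗ ℂ` (§3, eigenspace orthogonality and
`δ_{p−j} = conj δ_j`), hence lies in `W^⊥ ⊗ ℂ` by the non-degeneracy of `B` on `W` (Gram determinant).
Written by the prover seat `hodge-nonav-prover-Ax`.

## References
* [CarlsonToledo1999] J. A. Carlson, D. Toledo, *Discriminant complements and kernels of monodromy
  representations*, Duke Math. J. 97 (1999), §6 Proposition 2 (p. 14), §7 (p. 16).
-/

noncomputable section

open Module Literature.AlgebraicGeometry.Motives
open scoped TensorProduct ComplexConjugate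

namespace Literature.AlgebraicGeometry.HodgeTheory

universe v

variable {V : Type v} [AddCommGroup V] [Module ℚ V]

/-! ### §1 The complexified reflection on the cyclic span and on its orthogonal complement -/

/-- `r_ℂ = τ_ℂ` on `span_ℂ {1 ⊗ τ^i δ} = W ⊗ ℂ` when `r = τ` on the cyclic span `W`.
[cite: CarlsonToledo1999, §6 Proposition 2 (p. 14)] -/
theorem baseChange_apply_eq_of_mem_span {τ r : V →ₗ[ℚ] V} {δ : V}
    (hr1 : ∀ x ∈ Submodule.span ℚ (Set.range fun i : ℕ => (τ ^ i) δ), r x = τ x)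
    {y : ℂ ⊗[ℚ] V} (hy : y ∈ Submodule.span ℂ (Set.range fun i : ℕ => (1 : ℂ) ⊗ₜ[ℚ] ((τ ^ i) δ))) :
    r.baseChange ℂ y = τ.baseChange ℂ y := by
  refine LinearMap.eqOn_span' (f := r.baseChange ℂ) (g := τ.baseChange ℂ) ?_ hy
  rintro _ ⟨i, rfl⟩
  show r.baseChange ℂ _ = τ.baseChange ℂ _
  rw [LinearMap.baseChange_tmul, LinearMap.baseChange_tmul, hr1 _ (Submodule.subset_span ⟨i, rfl⟩)]

/-- `r_ℂ δ_j = ζ^j δ_j`: the eigencomponents of `δ` are eigenvectors of the complexified reflection.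
[cite: CarlsonToledo1999, §6 Proposition 2 (p. 14)] -/
theorem baseChange_reflection_eigencomponent {τ r : V →ₗ[ℚ] V} {p : ℕ} (hτ : τ ^ p = 1) {ζ : ℂ}
    (hζ : ζ ^ p = 1) (hζ0 : ζ ≠ 0) {δ : V}
    (hr1 : ∀ x ∈ Submodule.span ℚ (Set.range fun i : ℕ => (τ ^ i) δ), r x = τ x) (j : ℕ) :
    r.baseChange ℂ (eigencomponent τ p ζ j δ) = ζ ^ j • eigencomponent τ p ζ j δ := by
  rw [baseChange_apply_eq_of_mem_span hr1 (eigencomponent_mem_span τ p ζ j δ), baseChange_eigencomponent hτ hζ hζ0]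

/-- `r_ℂ = id` on `span_ℂ (1 ⊗ W^⊥) = W^⊥ ⊗ ℂ`, `W` the cyclic span, when `r` fixes every vector
`B`-orthogonal to `W` (`B` symmetric). [cite: CarlsonToledo1999, §6 Proposition 2 (p. 14)] -/
theorem baseChange_apply_eq_self_of_mem_span {τ r : V →ₗ[ℚ] V} {B : LinearMap.BilinForm ℚ V} (hB : B.IsSymm)
    {δ : V} (hr2 : ∀ x, (∀ y ∈ Submodule.span ℚ (Set.range fun i : ℕ => (τ ^ i) δ), B x y = 0) → r x = x)
    {z : ℂ ⊗[ℚ] V} (hz : z ∈ Submodule.span ℂ ((fun u : V => (1 : ℂ) ⊗ₜ[ℚ] u) ''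
      (B.orthogonal (Submodule.span ℚ (Set.range fun i : ℕ => (τ ^ i) δ)) : Set V))) :
    r.baseChange ℂ z = z := by
  have h := LinearMap.eqOn_span' (f := r.baseChange ℂ) (g := LinearMap.id) ?_ hz
  · simpa using h
  rintro _ ⟨u, hu, rfl⟩
  show r.baseChange ℂ _ = LinearMap.id _
  rw [LinearMap.id_apply, LinearMap.baseChange_tmul, hr2 u]
  intro y hy
  rw [hB.eq u y]
  exact (LinearMap.BilinForm.mem_orthogonal_iff.1 hu) y hy

/-! ### §2 `V = W ⊕ W^⊥`, complexified -/

/-- The restriction of a symmetric form to a subspace on which it is non-degenerate (one-sided) is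
non-degenerate in Mathlib's two-sided sense. [cite: CarlsonToledo1999, §6 (p. 13)] -/
theorem nondegenerate_restrict_of_forall {B : LinearMap.BilinForm ℚ V} (hB : B.IsSymm) {W : Submodule ℚ V}
    (hnd : ∀ x ∈ W, (∀ y ∈ W, B x y = 0) → x = 0) : (B.restrict W).Nondegenerate := by
  refine ⟨fun m hm => ?_, fun m hm => ?_⟩
  · refine Subtype.ext (hnd m m.2 fun y hy => ?_)
    have h := hm ⟨y, hy⟩
    simpa using h
  · refine Subtype.ext (hnd m m.2 fun y hy => ?_)
    have h := hm ⟨y, hy⟩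
    rw [hB.eq]
    simpa using h

/-- **`V ⊗ ℂ = (W ⊗ ℂ) + (W^⊥ ⊗ ℂ)`** for the cyclic span `W = span_ℚ {τ^i δ}` of a vanishing vector on which
`B` is non-degenerate ("`H^{n+1}(Y)` splits orthogonally as `V ⊕ V^⊥`"): every complex vector lies in
`span_ℂ {1 ⊗ τ^k δ : k < p − 1} ⊔ span_ℂ (1 ⊗ W^⊥)`. [cite: CarlsonToledo1999, §6 (p. 13)] -/
theorem mem_span_sup_span_orthogonal [Module.Finite ℚ V] {τ : V →ₗ[ℚ] V} {p : ℕ} (hp : 2 ≤ p)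
    (hτ : τ ^ p = 1) {B : LinearMap.BilinForm ℚ V} (hB : B.IsSymm) {δ : V}
    (hsum : ∑ i ∈ Finset.range p, (τ ^ i) δ = 0)
    (hnd : ∀ x ∈ Submodule.span ℚ (Set.range fun i : ℕ => (τ ^ i) δ),
      (∀ y ∈ Submodule.span ℚ (Set.range fun i : ℕ => (τ ^ i) δ), B x y = 0) → x = 0)
    (x : ℂ ⊗[ℚ] V) :
    x ∈ Submodule.span ℂ (Set.range fun k : Fin (p - 1) => (1 : ℂ) ⊗ₜ[ℚ] ((τ ^ (k : ℕ)) δ)) ⊔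
      Submodule.span ℂ ((fun u : V => (1 : ℂ) ⊗ₜ[ℚ] u) ''
        (B.orthogonal (Submodule.span ℚ (Set.range fun i : ℕ => (τ ^ i) δ)) : Set V)) := by
  set W := Submodule.span ℚ (Set.range fun i : ℕ => (τ ^ i) δ) with hW
  have hc : IsCompl W (B.orthogonal W) :=
    LinearMap.BilinForm.isCompl_orthogonal_of_restrict_nondegenerate hB.isRefl
      (nondegenerate_restrict_of_forall hB hnd)
  induction x using TensorProduct.induction_on with
  | zero => exact Submodule.zero_mem _
  | tmul a v =>
    have hv : v ∈ W ⊔ B.orthogonal W := by rw [hc.sup_eq_top]; trivial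
    obtain ⟨w, hw, u, hu, rfl⟩ := Submodule.mem_sup.1 hv
    rw [TensorProduct.tmul_add]
    refine Submodule.add_mem _ (Submodule.mem_sup_left ?_) (Submodule.mem_sup_right ?_)
    · rw [show a ⊗ₜ[ℚ] w = a • ((1 : ℂ) ⊗ₜ[ℚ] w) by rw [TensorProduct.smul_tmul', smul_eq_mul, mul_one]]
      refine Submodule.smul_mem _ _ ?_
      have hw' : w ∈ Submodule.span ℚ (Set.range fun k : Fin (p - 1) => (τ ^ (k : ℕ)) δ) := by
        rw [← span_pow_apply_eq hp hτ hsum]; exact hw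
      obtain ⟨q, hq⟩ := (Submodule.mem_span_range_iff_exists_fun ℚ).1 hw'
      rw [← hq, TensorProduct.tmul_sum]
      refine Submodule.sum_mem _ fun k _ => ?_
      rw [TensorProduct.tmul_smul, ← algebraMap_smul ℂ (q k)]
      exact Submodule.smul_mem _ _ (Submodule.subset_span ⟨k, rfl⟩)
    · rw [show a ⊗ₜ[ℚ] u = a • ((1 : ℂ) ⊗ₜ[ℚ] u) by rw [TensorProduct.smul_tmul', smul_eq_mul, mul_one]]
      exact Submodule.smul_mem _ _ (Submodule.subset_span ⟨u, hu, rfl⟩)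
  | add x y hx hy => exact Submodule.add_mem _ hx hy

/-! ### §3 `h(δ_j, x) = 0` on `H(ζ^j)` forces `B_ℂ`-orthogonality to the whole cyclic span -/

/-- **`δ_j(ζ̄) = δ_{p−j}(ζ)`**: the eigencomponent for the conjugate root of unity is the complementary
eigencomponent (`ζ̄ = ζ^{-1}`, `ζ^p = 1`); with `conjV_eigencomponent`, `conj δ_j = δ_{p−j}`.
[cite: CarlsonToledo1999, §2 (p. 5)] -/
theorem eigencomponent_conj (τ : V →ₗ[ℚ] V) {p : ℕ} {ζ : ℂ} (hζ : IsPrimitiveRoot ζ p) (hp : 0 < p) {j : ℕ}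
    (hj : j ≤ p) (δ : V) :
    eigencomponent τ p (conj ζ) j δ = eigencomponent τ p ζ (p - j) δ := by
  have hζ1 : ‖ζ‖ = 1 := hζ.norm'_eq_one hp.ne'
  rw [eigencomponent_def, eigencomponent_def, cyclicEigenProjector_apply, cyclicEigenProjector_apply]
  congr 1
  refine Finset.sum_congr rfl fun i _ => ?_
  congr 1
  rw [← Complex.inv_eq_conj hζ1, inv_inv, inv_pow]
  have h : ζ ^ (i * (p - j)) * ζ ^ (i * j) = 1 := by
    rw [← pow_add, ← mul_add, Nat.sub_add_cancel hj, pow_mul', hζ.pow_eq_one, one_pow]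
  exact eq_inv_of_mul_eq_one_right h

/-- **A vector of `H(ζ^j)` that is `h`-orthogonal to `δ_j` is `B_ℂ`-orthogonal to every `1 ⊗ τ^k δ`**
(`1 ≤ j < p`): expanding `1 ⊗ τ^k δ = Σ_m ζ^{km} δ_m`, the terms `m ≠ p − j` vanish by eigenspace
`B_ℂ`-orthogonality (`ζ^j ζ^m ≠ 1`) and the term `m = p − j` is `B_ℂ(x, conj δ_j) = h(δ_j, x) = 0`.
[cite: CarlsonToledo1999, §6 Proposition 2 (p. 14)] -/
theorem baseChange_one_tmul_pow_apply_eq_zero {τ : V →ₗ[ℚ] V} {p : ℕ} (hp : p.Prime) (hτ : τ ^ p = 1)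
    {ζ : ℂ} (hζ : IsPrimitiveRoot ζ p) {B : LinearMap.BilinForm ℚ V} (hB : B.IsSymm)
    (hτB : ∀ v w, B (τ v) (τ w) = B v w) (δ : V) {j : ℕ} (hj1 : 1 ≤ j) (hjp : j < p) {x : ℂ ⊗[ℚ] V}
    (hx : x ∈ Module.End.eigenspace (τ.baseChange ℂ) (ζ ^ j))
    (h0 : hermitianOfBilin B (eigencomponent τ p ζ j δ) x = 0) (k : ℕ) :
    B.baseChange ℂ x ((1 : ℂ) ⊗ₜ ((τ ^ k) δ)) = 0 := by
  have hp0 : 0 < p := hp.pos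
  have hζ0 : ζ ≠ 0 := hζ.ne_zero hp0.ne'
  rw [tmul_pow_apply_eq_sum_eigencomponent hτ hζ hp0 k δ, map_sum]
  refine Finset.sum_eq_zero fun m hm => ?_
  have hmp : m < p := Finset.mem_range.1 hm
  rw [map_smul, smul_eq_mul]
  by_cases hmj : m = p - j
  · -- `δ_{p-j} = conj δ_j` and `B_ℂ(x, conj δ_j) = B_ℂ(conj δ_j, x) = h(δ_j, x) = 0`
    rw [hmj, ← eigencomponent_conj τ hζ hp0 hjp.le δ, ← conjV_eigencomponent]
    have hs := (LinearMap.BilinForm.IsSymm.baseChange (A := ℂ) (LinearMap.BilinForm.isSymm_iff.1 hB)).eq x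
      (conjV V (eigencomponent τ p ζ j δ))
    rw [RingHom.id_apply] at hs
    rw [← hermitianOfBilin_apply] at hs
    first
      | rw [← hs, h0, mul_zero]
      | rw [hs, h0, mul_zero]
  · rw [baseChange_eq_zero_of_mem_eigenspace hτB ?_ hx (eigencomponent_mem_eigenspace hτ hζ.pow_eq_one hζ0 m δ),
      mul_zero]
    intro h1
    apply hmj
    refine hζ.pow_inj hmp (by omega) ?_
    have h2 : ζ ^ (p - j) * ζ ^ j = 1 := by rw [← pow_add, Nat.sub_add_cancel hjp.le, hζ.pow_eq_one]
    calc ζ ^ m = (ζ ^ j)⁻¹ := eq_inv_of_mul_eq_one_right h1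
      _ = ζ ^ (p - j) := (eq_inv_of_mul_eq_one_left h2).symm

/-! ### §4 The reflection formula on `H(ζ^j)` -/

/-- **Carlson–Toledo's Proposition 2 (§6), eigenspace form.**  Let `r` be a cyclic reflection of `(V, B)`
with vanishing vector `δ` (`r = τ` on `W = span_ℚ {τ^i δ}`, `r = id` on `W^⊥`; `δ ≠ 0`, `Σ_{i<p} τ^i δ = 0`,
`B` symmetric, `τ`-invariant and non-degenerate on `W`; `p` prime, `ζ` a primitive `p`-th root of unity).
Then for `1 ≤ j < p` and `x ∈ H(ζ^j)`,
`r_ℂ x = x + (ζ^j − 1) · (h(δ_j, x) / h(δ_j, δ_j)) · δ_j` — `r_ℂ|H(ζ^j)` is the complex reflection with root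
`δ_j`, multiplier `ζ^j`, for the hermitian form `h` ("`T_δ` acts on `H^n_{ζ^i}(X)` as `T^i_{δ_i}`, with
`T^i_{δ_i}(x) = x + (ζ^i − 1) ε_i h(x, δ_i) δ_i` once `h(δ_i, δ_i) = ε_i = ±1`").
[cite: CarlsonToledo1999, §6 Proposition 2 (p. 14) and §7 (p. 16)] -/
theorem baseChange_reflection_apply_of_mem_eigenspace [Module.Finite ℚ V] {τ r : V →ₗ[ℚ] V} {p : ℕ}
    (hp : p.Prime) (hτ : τ ^ p = 1) {ζ : ℂ} (hζ : IsPrimitiveRoot ζ p) {B : LinearMap.BilinForm ℚ V}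
    (hB : B.IsSymm) (hτB : ∀ v w, B (τ v) (τ w) = B v w) {δ : V} (hδ : δ ≠ 0)
    (hsum : ∑ i ∈ Finset.range p, (τ ^ i) δ = 0)
    (hnd : ∀ x ∈ Submodule.span ℚ (Set.range fun i : ℕ => (τ ^ i) δ),
      (∀ y ∈ Submodule.span ℚ (Set.range fun i : ℕ => (τ ^ i) δ), B x y = 0) → x = 0)
    (hr1 : ∀ x ∈ Submodule.span ℚ (Set.range fun i : ℕ => (τ ^ i) δ), r x = τ x)
    (hr2 : ∀ x, (∀ y ∈ Submodule.span ℚ (Set.range fun i : ℕ => (τ ^ i) δ), B x y = 0) → r x = x)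
    {j : ℕ} (hj1 : 1 ≤ j) (hjp : j < p) {x : ℂ ⊗[ℚ] V}
    (hx : x ∈ Module.End.eigenspace (τ.baseChange ℂ) (ζ ^ j)) :
    r.baseChange ℂ x = x + ((ζ ^ j - 1) * (hermitianOfBilin B (eigencomponent τ p ζ j δ) x /
      hermitianOfBilin B (eigencomponent τ p ζ j δ) (eigencomponent τ p ζ j δ))) • eigencomponent τ p ζ j δ := by
  have hp0 : 0 < p := hp.pos
  have hζ0 : ζ ≠ 0 := hζ.ne_zero hp0.ne'
  have hdd : hermitianOfBilin B (eigencomponent τ p ζ j δ) (eigencomponent τ p ζ j δ) ≠ 0 :=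
    hermitianOfBilin_eigencomponent_self_ne_zero hp hτ hζ hB hτB hδ hsum hnd hj1 hjp
  set d := eigencomponent τ p ζ j δ with hd
  set c : ℂ := hermitianOfBilin B d x / hermitianOfBilin B d d with hc
  -- `x' := x - c • d ∈ H(ζ^j)` with `h(d, x') = 0`
  obtain ⟨x', hx'⟩ : ∃ x' : ℂ ⊗[ℚ] V, x' = x - c • d := ⟨_, rfl⟩
  have hx'mem : x' ∈ Module.End.eigenspace (τ.baseChange ℂ) (ζ ^ j) := by
    rw [hx']
    exact Submodule.sub_mem _ hx (Submodule.smul_mem _ _ (eigencomponent_mem_eigenspace hτ hζ.pow_eq_one hζ0 j δ))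
  have h0 : hermitianOfBilin B d x' = 0 := by
    rw [hx', map_sub, map_smul, smul_eq_mul, hc, div_mul_cancel₀ _ hdd, sub_self]
  -- decompose `x' = a + b` along `(W ⊗ ℂ) + (W^⊥ ⊗ ℂ)`
  obtain ⟨a, ha, b, hb, hab⟩ := Submodule.mem_sup.1 (mem_span_sup_span_orthogonal hp.two_le hτ hB hsum hnd x')
  -- `b` is `B_ℂ`-orthogonal to each `1 ⊗ τ^k δ`
  have hbO : ∀ k : ℕ, B.baseChange ℂ b ((1 : ℂ) ⊗ₜ ((τ ^ k) δ)) = 0 := by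
    intro k
    have h := LinearMap.eqOn_span' (f := (B.baseChange ℂ).flip ((1 : ℂ) ⊗ₜ[ℚ] ((τ ^ k) δ))) (g := 0) ?_ hb
    · simpa using h
    rintro _ ⟨u, hu, rfl⟩
    have hu' : B ((τ ^ k) δ) u = 0 :=
      (LinearMap.BilinForm.mem_orthogonal_iff.1 hu) _ (Submodule.subset_span ⟨k, rfl⟩)
    show B.baseChange ℂ ((1 : ℂ) ⊗ₜ[ℚ] u) ((1 : ℂ) ⊗ₜ[ℚ] ((τ ^ k) δ)) = 0
    rw [LinearMap.BilinForm.baseChange_tmul, mul_one, hB.eq u, hu', zero_smul]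
  -- hence so is `a`, and `a = 0` by the non-degeneracy of `B_ℂ` on the complexified span
  have hli := linearIndependent_pow_apply_of_sum_eq_zero hp hδ hsum
  have hnd' : ∀ y ∈ Submodule.span ℚ (Set.range fun k : Fin (p - 1) => (τ ^ (k : ℕ)) δ),
      (∀ z ∈ Submodule.span ℚ (Set.range fun k : Fin (p - 1) => (τ ^ (k : ℕ)) δ), B y z = 0) → y = 0 := by
    rw [← span_pow_apply_eq hp.two_le hτ hsum]; exact hnd
  have ha0 : a = 0 := by
    refine eq_zero_of_mem_span_tmul_of_forall_baseChange_eq_zero hB _ hli hnd' ha fun k => ?_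
    have hk := baseChange_one_tmul_pow_apply_eq_zero hp hτ hζ hB hτB δ hj1 hjp hx'mem h0 (k : ℕ)
    rw [← hab, map_add, LinearMap.add_apply, hbO, add_zero] at hk
    exact hk
  -- so `x' = b` is fixed by `r_ℂ`
  have hfix : r.baseChange ℂ x' = x' := by
    rw [← hab, ha0, zero_add]
    exact baseChange_apply_eq_self_of_mem_span hB hr2 hb
  have hrd : r.baseChange ℂ d = ζ ^ j • d := baseChange_reflection_eigencomponent hτ hζ.pow_eq_one hζ0 hr1 j
  have hxd : x = x' + c • d := by rw [hx', sub_add_cancel]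
  calc r.baseChange ℂ x = r.baseChange ℂ x' + c • r.baseChange ℂ d := by
        rw [hxd, map_add, map_smul]
    _ = x' + c • (ζ ^ j • d) := by rw [hfix, hrd]
    _ = x + ((ζ ^ j - 1) * c) • d := by
        rw [hx', smul_smul, sub_mul, one_mul, sub_smul, mul_comm (ζ ^ j) c]
        abel

end Literature.AlgebraicGeometry.HodgeTheory

end
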